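import Summits.ValiantsHypothesis.ValiantsHypothesis.Theorems.LacunarySymmetroidMatrixDescartesPivotResolventSlope

/-!
# `MatrixDescartes` census — rank-one `(2,4)₁`: the ENVELOPE FORM of the resolvent slope and the LETTER VOTES
# (the slope numerator `Rτ_e + π_e` is a `(dₖ − e)`-SIGNED SUM OF SQUARES along the optimal negative direction; eliminating the
# below-pivot letter turns it into a weighted vote `∑_{k≥1} aₖ κₖ` with explicit cubics `κₖ`; chamber-(C) letters vote in BANDS)

HONEST FRAMING.  Object-search cell `pub-symmetroid`, seat `val-sym-mdr-p1` (generation 19); helper file `--supports` the crux item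
stmt-ValiantsHypothesis-18050 (`Theses.LacunarySymmetroid.MatrixDescartes`, OPEN, on HOLD) with NO closure claim.  Companion of
`…PivotResolventSlope` (g18: the profile `y ↦ R(y)/y^e`, `R = (τ + S)/(2δ)`, has slope `(Rτ_e + π_e)/(S x^{e+1})`).  THIS FILE:
* §1 **ENVELOPE IDENTITY** (general symmetric `J`, pure algebra, `envelope_identity`): with `z = (RJ₁₁ + C, −(RJ₀₁ + U))` — a kernel
  vector of the PSD-breaking matrix `RJ + G` (`kernel_fst`, `kernel_snd`) — one has `(Rτ_e + π_e)·(−zᵀJz) = S·(zᵀG_e z)` whenever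
  `−δR² + τR + π = 0` (`G = [[A,U],[U,C]]`, `G_e = [[A_e,U_e],[U_e,C_e]]`, `τ_e = J₀₀C_e − 2J₀₁U_e + J₁₁A_e`, `π_e = A_eC + AC_e − 2UU_e`,
  `S = 2δR − τ`); and `−zᵀJz = zᵀGz/R ≥ 0` for `G ⪰ 0`, `R > 0` (`neg_zJz_nonneg`).  For the letter pencil `G_e = ∑ₖ (dₖ − e)wₖx^{dₖ}vₖvₖᵀ`,
  so `zᵀG_e z = ∑ₖ (dₖ − e)·wₖx^{dₖ}·(vₖ·z)²` (`quadForm_letters`): **the profile falls at `x` iff the (dₖ − e)-signed sum of squares of the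
  letters seen from the optimal negative direction `z(x)` is negative** (`deriv_resolventProfile_sign_envelope`, the envelope theorem
  for `R(x) = min_z zᵀG(x)z/(−zᵀJz)` made algebraic).  On the `1|3` split only letter `0` carries a negative sign: a turning point needs
  `(e − d₀)·w₀x^{d₀}(v₀·z)² = ∑_{k≥1} (dₖ − e)·wₖx^{dₖ}(vₖ·z)²`.
* §2 **VOTING IDENTITY** (`voting_identity`, general `J`; `voting_identity_rms`, hyperbolic normal form): the kernel relation lets one
  ELIMINATE the below-pivot letter: `det(Jz, v₀)·∑ₖ εₖaₖ(vₖ·z)² = ∑_{k≥1} aₖ·κ̃ₖ(z)` with the explicit binary cubics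
  `κ̃ₖ(z) = (vₖ·z)·[εₖ(vₖ·z)·det(Jz,v₀) − ε₀(v₀·z)·det(Jz,vₖ)]` (`εₖ = dₖ − e`).  In normal form (`J` antidiagonal, `vₖ = (1,tₖ)`, `z = (g,−1)`,
  `g = √(C/A)` the RMS direction): `(g + t₀)·∑ₖ εₖaₖ(g − tₖ)² = ∑_{k≥1} aₖ κₖ(g)`, `κₖ(g) = (g − tₖ)·qₖ(g)`,
  `qₖ(g) = (εₖ − ε₀)g² + (εₖ + ε₀)(t₀ − tₖ)g − (εₖ − ε₀)t₀tₖ`: letter `k ≥ 1` VOTES for a dip (`κₖ(g) < 0`) iff `g` lies strictly between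
  `tₖ` and the unique positive root `ρₖ` of `qₖ`, which lies between `t₀` and `tₖ` (`q_at_t0`, `q_at_tk`, `q_div_mono`).
* §3 **CHAMBER-(C) BANDS** (`vote_band_of_neg`, `vote_band_of_neg'`, `vote_neg_of_mem`): if `d₀ + dₖ > 2e` (letters 2, 3 in chamber (C)) the
  vote of letter `k` is negative ONLY in the relative band `cₖtₖ < g < tₖ` (resp. `tₖ < g < tₖ/cₖ`), `cₖ = (dₖ + d₀ − 2e)/(dₖ − d₀) ∈ (0,1)`; if
  `d₀ + d₁ < 2e` (letter 1 in (C)) the vote of letter 1 IS negative on the whole range `C₁t₀ < g < t₁` (resp. `t₁ < g < t₀/C₁`),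
  `C₁ = (d₁ − d₀)/(2e − d₀ − d₁)`: the first two (C)-inequalities make letter 1 a GLOBAL dip-voter and letters 2, 3 LOCAL ones.
READING (seat memo DIP-VOTES.md, evidence on the item): every turning point of the profile has its RMS direction `g` in a voting
interval `Jₖ`; located dips in (C) are «one letter-1 vote» + «one vote of letter 2 OR 3» (≤ 2 dips, `Z₊ ≤ 5` in ≈ 10³ adversarial
designs); the count — hence «(C) ≤ 8» — stays OPEN.  Nothing here bears on `MatrixDescartes` in its window, on `DoorA26` / `DoorA34`,
registers / credences, or `VP ≠ VNP`; the rank-one register is unchanged.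

[folklore] Elementary algebra (`linear_combination`, `nlinarith`) and the tree lemma `hasDerivAt_resolventProfile`.  No definitions,
no named facts.
-/

-- `Summit.ValiantsHypothesis.ValiantsHypothesis.…` repeats a component by the D-0017 layout
-- (single-conjunct summit), which the `dupNamespace` linter flags; the name is mandated.
set_option linter.dupNamespace false

namespace Summit.ValiantsHypothesis.ValiantsHypothesis.Theorems.LacunarySymmetroidMatrixDescartes.Pivot.Resolvent

open Polynomial Set
open scoped BigOperators

/-! ## 1. The envelope identity (general symmetric `J`) -/

/-- **Kernel vector, first row.**  With `δ = J₀₁² − J₀₀J₁₁`, `τ = J₀₀C − 2J₀₁U + J₁₁A`, `π = AC − U²` and `z = (RJ₁₁ + C, −(RJ₀₁ + U))`: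
`(RJ₀₀ + A)z₀ + (RJ₀₁ + U)z₁ = −δR² + τR + π` (`= det(RJ + G)`). [folklore] -/
theorem kernel_fst (J₀₀ J₀₁ J₁₁ R A U C : ℝ) :
    (R * J₀₀ + A) * (R * J₁₁ + C) + (R * J₀₁ + U) * (-(R * J₀₁ + U))
      = -(J₀₁ ^ 2 - J₀₀ * J₁₁) * R ^ 2 + (J₀₀ * C - 2 * J₀₁ * U + J₁₁ * A) * R + (A * C - U ^ 2) := by
  ring

/-- **Kernel vector, second row** (identically zero). [folklore] -/
theorem kernel_snd (J₀₁ J₁₁ R U C : ℝ) :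
    (R * J₀₁ + U) * (R * J₁₁ + C) + (R * J₁₁ + C) * (-(R * J₀₁ + U)) = 0 := by
  ring

/-- **ENVELOPE IDENTITY.**  If `R` is a root of `−δy² + τy + π` then, with `S = 2δR − τ`, `z = (RJ₁₁ + C, −(RJ₀₁ + U))`,
`τ_e = J₀₀C_e − 2J₀₁U_e + J₁₁A_e`, `π_e = A_eC + AC_e − 2UU_e`:
`(R·τ_e + π_e)·(−zᵀJz) = S·(zᵀG_e z)`.  (Envelope theorem for `R = min_z zᵀGz/(−zᵀJz)`, made algebraic.) [this file] -/
theorem envelope_identity (J₀₀ J₀₁ J₁₁ R A U C Ae Ue Ce : ℝ)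
    (hR : -(J₀₁ ^ 2 - J₀₀ * J₁₁) * R ^ 2 + (J₀₀ * C - 2 * J₀₁ * U + J₁₁ * A) * R + (A * C - U ^ 2) = 0) :
    (R * (J₀₀ * Ce - 2 * J₀₁ * Ue + J₁₁ * Ae) + (Ae * C + A * Ce - 2 * U * Ue))
        * (-(J₀₀ * (R * J₁₁ + C) ^ 2 + 2 * J₀₁ * ((R * J₁₁ + C) * (-(R * J₀₁ + U))) + J₁₁ * (-(R * J₀₁ + U)) ^ 2))
      = (2 * (J₀₁ ^ 2 - J₀₀ * J₁₁) * R - (J₀₀ * C - 2 * J₀₁ * U + J₁₁ * A))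
        * (Ae * (R * J₁₁ + C) ^ 2 + 2 * Ue * ((R * J₁₁ + C) * (-(R * J₀₁ + U))) + Ce * (-(R * J₀₁ + U)) ^ 2) := by
  linear_combination ((-J₀₀ * J₁₁ * Ce + 2 * J₀₁ ^ 2 * Ce - 2 * J₀₁ * J₁₁ * Ue + J₁₁ ^ 2 * Ae) * R
    + (-J₀₀ * C * Ce + 2 * J₀₁ * U * Ce - 2 * J₁₁ * U * Ue + J₁₁ * C * Ae)) * hR

/-- **The kernel direction is non-positive for `J`.**  If `R > 0` is a root of `−δy² + τy + π` and `G = [[A,U],[U,C]] ⪰ 0`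
(`A ≥ 0`, `C ≥ 0`, `U² ≤ AC`), then `−zᵀJz ≥ 0` for `z = (RJ₁₁ + C, −(RJ₀₁ + U))` — indeed `R·zᵀJz = −zᵀGz`. [this file] -/
theorem neg_zJz_nonneg (J₀₀ J₀₁ J₁₁ R A U C : ℝ) (hRpos : 0 < R) (hA : 0 ≤ A) (hC : 0 ≤ C) (hAC : U ^ 2 ≤ A * C)
    (hR : -(J₀₁ ^ 2 - J₀₀ * J₁₁) * R ^ 2 + (J₀₀ * C - 2 * J₀₁ * U + J₁₁ * A) * R + (A * C - U ^ 2) = 0) :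
    0 ≤ -(J₀₀ * (R * J₁₁ + C) ^ 2 + 2 * J₀₁ * ((R * J₁₁ + C) * (-(R * J₀₁ + U))) + J₁₁ * (-(R * J₀₁ + U)) ^ 2) := by
  set z₀ := R * J₁₁ + C with hz₀
  set z₁ := -(R * J₀₁ + U) with hz₁
  -- `R·zᵀJz + zᵀGz = zᵀ(RJ + G)z = z₀·det = 0`
  have hker : R * (J₀₀ * z₀ ^ 2 + 2 * J₀₁ * (z₀ * z₁) + J₁₁ * z₁ ^ 2) + (A * z₀ ^ 2 + 2 * U * (z₀ * z₁) + C * z₁ ^ 2) = 0 := by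
    have h1 := kernel_fst J₀₀ J₀₁ J₁₁ R A U C
    rw [hR] at h1
    have h2 := kernel_snd J₀₁ J₁₁ R U C
    rw [hz₀, hz₁]
    linear_combination (R * J₁₁ + C) * h1 + (-(R * J₀₁ + U)) * h2
  -- `zᵀGz ≥ 0`
  have hG : 0 ≤ A * z₀ ^ 2 + 2 * U * (z₀ * z₁) + C * z₁ ^ 2 := by
    rcases eq_or_lt_of_le hA with hA0 | hA0
    · have hU : U = 0 := by nlinarith [sq_nonneg U]
      rw [← hA0, hU]; nlinarith [sq_nonneg z₁]
    · have hid : A * (A * z₀ ^ 2 + 2 * U * (z₀ * z₁) + C * z₁ ^ 2) = (A * z₀ + U * z₁) ^ 2 + (A * C - U ^ 2) * z₁ ^ 2 := by ring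
      have : 0 ≤ A * (A * z₀ ^ 2 + 2 * U * (z₀ * z₁) + C * z₁ ^ 2) := by
        rw [hid]; nlinarith [sq_nonneg (A * z₀ + U * z₁), mul_nonneg (sub_nonneg.2 hAC) (sq_nonneg z₁)]
      by_contra hneg
      push Not at hneg
      nlinarith [mul_pos hA0 (neg_pos.2 hneg)]
  nlinarith

/-- **Letter form of `zᵀG_e z`.**  If `A_e, U_e, C_e` are the entries of `∑ₖ εₖ aₖ vₖvₖᵀ` (four letters, `aₖ = wₖx^{dₖ}`,
`εₖ = dₖ − e`), then `zᵀG_e z = ∑ₖ εₖ aₖ (vₖ·z)²`. [folklore] -/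
theorem quadForm_letters (ε₀ ε₁ ε₂ ε₃ a₀ a₁ a₂ a₃ p₀ q₀ p₁ q₁ p₂ q₂ p₃ q₃ z₀ z₁ Ae Ue Ce : ℝ)
    (hA : Ae = ε₀ * a₀ * p₀ ^ 2 + ε₁ * a₁ * p₁ ^ 2 + ε₂ * a₂ * p₂ ^ 2 + ε₃ * a₃ * p₃ ^ 2)
    (hU : Ue = ε₀ * a₀ * (p₀ * q₀) + ε₁ * a₁ * (p₁ * q₁) + ε₂ * a₂ * (p₂ * q₂) + ε₃ * a₃ * (p₃ * q₃))
    (hC : Ce = ε₀ * a₀ * q₀ ^ 2 + ε₁ * a₁ * q₁ ^ 2 + ε₂ * a₂ * q₂ ^ 2 + ε₃ * a₃ * q₃ ^ 2) :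
    Ae * z₀ ^ 2 + 2 * Ue * (z₀ * z₁) + Ce * z₁ ^ 2
      = ε₀ * a₀ * (p₀ * z₀ + q₀ * z₁) ^ 2 + ε₁ * a₁ * (p₁ * z₀ + q₁ * z₁) ^ 2 + ε₂ * a₂ * (p₂ * z₀ + q₂ * z₁) ^ 2
        + ε₃ * a₃ * (p₃ * z₀ + q₃ * z₁) ^ 2 := by
  subst hA hU hC; ring

/-- The resolvent root satisfies its quadratic: with `S = √(τ² + 4δπ)`, `R = (τ + S)/(2δ)` one has `−δR² + τR + π = 0`. [folklore] -/
theorem resolventRoot_isRoot (δ τ π : ℝ) (hδ : 0 < δ) (hdisc : 0 ≤ τ ^ 2 + 4 * δ * π) :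
    -δ * ((τ + Real.sqrt (τ ^ 2 + 4 * δ * π)) / (2 * δ)) ^ 2 + τ * ((τ + Real.sqrt (τ ^ 2 + 4 * δ * π)) / (2 * δ)) + π = 0 := by
  set S := Real.sqrt (τ ^ 2 + 4 * δ * π) with hS
  have hS2 : S ^ 2 = τ ^ 2 + 4 * δ * π := Real.sq_sqrt hdisc
  have hδ0 : δ ≠ 0 := hδ.ne'
  have key : -δ * ((τ + S) / (2 * δ)) ^ 2 + τ * ((τ + S) / (2 * δ)) + π = (τ ^ 2 + 4 * δ * π - S ^ 2) / (4 * δ) := by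
    field_simp
    ring
  rw [key, hS2]; ring

/-- **ENVELOPE LAW FOR THE SLOPE.**  Let `δ > 0`, `x > 0`, positive discriminant, and suppose the VALUES at `x` of `τ, π` and of the
tilts `xτ′ − eτ`, `xπ′ − 2eπ` are those of a symmetric `2 × 2` pencil: `τ(x) = J₀₀C − 2J₀₁U + J₁₁A`, `π(x) = AC − U²`,
`τ_e(x) = J₀₀C_e − 2J₀₁U_e + J₁₁A_e`, `π_e(x) = A_eC + AC_e − 2UU_e`, `δ = J₀₁² − J₀₀J₁₁`.  Let `R = R(x) = (τ(x) + S(x))/(2δ)` and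
`z = (RJ₁₁ + C, −(RJ₀₁ + U))` with `−zᵀJz > 0`.  Then the profile `y ↦ R(y)/y^e` FALLS at `x` if `zᵀG_e z < 0` and RISES at `x` if
`zᵀG_e z > 0`. [this file + `…ResolventSlope`] -/
theorem deriv_resolventProfile_sign_envelope (δ : ℝ) (e : ℕ) (τ π : ℝ[X]) (x : ℝ) (hδ : 0 < δ) (hx : 0 < x)
    (hdisc : 0 < (τ.eval x) ^ 2 + 4 * δ * π.eval x) (J₀₀ J₀₁ J₁₁ A U C Ae Ue Ce R z₀ z₁ : ℝ)
    (hδJ : δ = J₀₁ ^ 2 - J₀₀ * J₁₁) (hτ : τ.eval x = J₀₀ * C - 2 * J₀₁ * U + J₁₁ * A) (hπ : π.eval x = A * C - U ^ 2)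
    (hτe : x * τ.derivative.eval x - e * τ.eval x = J₀₀ * Ce - 2 * J₀₁ * Ue + J₁₁ * Ae)
    (hπe : x * π.derivative.eval x - 2 * e * π.eval x = Ae * C + A * Ce - 2 * U * Ue)
    (hR : R = (τ.eval x + Real.sqrt ((τ.eval x) ^ 2 + 4 * δ * π.eval x)) / (2 * δ))
    (hz₀ : z₀ = R * J₁₁ + C) (hz₁ : z₁ = -(R * J₀₁ + U))
    (hz : 0 < -(J₀₀ * z₀ ^ 2 + 2 * J₀₁ * (z₀ * z₁) + J₁₁ * z₁ ^ 2)) :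
    ((Ae * z₀ ^ 2 + 2 * Ue * (z₀ * z₁) + Ce * z₁ ^ 2 < 0) →
        deriv (fun y => ((τ.eval y + Real.sqrt ((τ.eval y) ^ 2 + 4 * δ * π.eval y)) / (2 * δ)) / y ^ e) x < 0)
    ∧ ((0 < Ae * z₀ ^ 2 + 2 * Ue * (z₀ * z₁) + Ce * z₁ ^ 2) →
        0 < deriv (fun y => ((τ.eval y + Real.sqrt ((τ.eval y) ^ 2 + 4 * δ * π.eval y)) / (2 * δ)) / y ^ e) x) := by
  have hD := hasDerivAt_resolventProfile δ e τ π x hδ hx hdisc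
  rw [hD.deriv]
  set S := Real.sqrt ((τ.eval x) ^ 2 + 4 * δ * π.eval x) with hSdef
  have hSpos : 0 < S := Real.sqrt_pos.2 hdisc
  have hden : 0 < S * x ^ (e + 1) := mul_pos hSpos (pow_pos hx _)
  -- the root relation and the envelope identity at `x`
  have hroot : -(J₀₁ ^ 2 - J₀₀ * J₁₁) * R ^ 2 + (J₀₀ * C - 2 * J₀₁ * U + J₁₁ * A) * R + (A * C - U ^ 2) = 0 := by
    have h := resolventRoot_isRoot δ (τ.eval x) (π.eval x) hδ hdisc.le
    rw [← hSdef, ← hR, hτ, hπ, hδJ] at h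
    linear_combination h
  have henv := envelope_identity J₀₀ J₀₁ J₁₁ R A U C Ae Ue Ce hroot
  -- `S = 2δR − τ`
  have hS : 2 * (J₀₁ ^ 2 - J₀₀ * J₁₁) * R - (J₀₀ * C - 2 * J₀₁ * U + J₁₁ * A) = S := by
    rw [← hδJ, ← hτ, hR]; field_simp; ring
  rw [hS, ← hz₀, ← hz₁] at henv
  -- numerator `N = Rτ_e + π_e`
  have hN : R * (x * τ.derivative.eval x - e * τ.eval x) + (x * π.derivative.eval x - 2 * e * π.eval x)
      = R * (J₀₀ * Ce - 2 * J₀₁ * Ue + J₁₁ * Ae) + (Ae * C + A * Ce - 2 * U * Ue) := by rw [hτe, hπe]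
  rw [← hR, hN]
  set N := R * (J₀₀ * Ce - 2 * J₀₁ * Ue + J₁₁ * Ae) + (Ae * C + A * Ce - 2 * U * Ue) with hNdef
  set Q := -(J₀₀ * z₀ ^ 2 + 2 * J₀₁ * (z₀ * z₁) + J₁₁ * z₁ ^ 2) with hQ
  set W := Ae * z₀ ^ 2 + 2 * Ue * (z₀ * z₁) + Ce * z₁ ^ 2 with hW
  -- `N·Q = S·W` with `Q > 0`, `S > 0`
  refine ⟨fun hWneg => div_neg_of_neg_of_pos ?_ hden, fun hWpos => div_pos ?_ hden⟩
  · by_contra hcon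
    push Not at hcon
    have h1 : 0 ≤ N * Q := mul_nonneg hcon hz.le
    have h2 : S * W < 0 := mul_neg_of_pos_of_neg hSpos hWneg
    linarith
  · by_contra hcon
    push Not at hcon
    have h1 : N * Q ≤ 0 := mul_nonpos_of_nonpos_of_nonneg hcon hz.le
    have h2 : 0 < S * W := mul_pos hSpos hWpos
    linarith

/-! ## 2. The voting identity: eliminating the below-pivot letter -/

/-- **VOTING IDENTITY (general `J`).**  For a symmetric `J`, a direction `z`, letters `vₖ = (pₖ, qₖ)` with masses `aₖ` and signs `εₖ`
(`k = 0,…,3`), write `Jz = (J₀₀z₀ + J₀₁z₁, J₀₁z₀ + J₁₁z₁)`, `det(u,v) = u₀v₁ − u₁v₀`, `sₖ = vₖ·z`.  If `det(Jz, ∑ₖ aₖsₖvₖ) = 0` (true for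
the kernel direction: `∑ₖ aₖsₖvₖ = Gz = −R·Jz`), then
`det(Jz, v₀) · ∑ₖ εₖaₖsₖ² = ∑_{k≥1} aₖ sₖ [εₖ sₖ det(Jz,v₀) − ε₀ s₀ det(Jz,vₖ)]` — the below-pivot letter is eliminated. [this file] -/
theorem voting_identity (J₀₀ J₀₁ J₁₁ z₀ z₁ ε₀ ε₁ ε₂ ε₃ a₀ a₁ a₂ a₃ p₀ q₀ p₁ q₁ p₂ q₂ p₃ q₃ : ℝ)
    (hdet : (J₀₀ * z₀ + J₀₁ * z₁) * (a₀ * (p₀ * z₀ + q₀ * z₁) * q₀ + a₁ * (p₁ * z₀ + q₁ * z₁) * q₁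
              + a₂ * (p₂ * z₀ + q₂ * z₁) * q₂ + a₃ * (p₃ * z₀ + q₃ * z₁) * q₃)
          - (J₀₁ * z₀ + J₁₁ * z₁) * (a₀ * (p₀ * z₀ + q₀ * z₁) * p₀ + a₁ * (p₁ * z₀ + q₁ * z₁) * p₁
              + a₂ * (p₂ * z₀ + q₂ * z₁) * p₂ + a₃ * (p₃ * z₀ + q₃ * z₁) * p₃) = 0) :
    ((J₀₀ * z₀ + J₀₁ * z₁) * q₀ - (J₀₁ * z₀ + J₁₁ * z₁) * p₀)
        * (ε₀ * a₀ * (p₀ * z₀ + q₀ * z₁) ^ 2 + ε₁ * a₁ * (p₁ * z₀ + q₁ * z₁) ^ 2 + ε₂ * a₂ * (p₂ * z₀ + q₂ * z₁) ^ 2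
          + ε₃ * a₃ * (p₃ * z₀ + q₃ * z₁) ^ 2)
      = a₁ * (p₁ * z₀ + q₁ * z₁) * (ε₁ * (p₁ * z₀ + q₁ * z₁) * ((J₀₀ * z₀ + J₀₁ * z₁) * q₀ - (J₀₁ * z₀ + J₁₁ * z₁) * p₀)
          - ε₀ * (p₀ * z₀ + q₀ * z₁) * ((J₀₀ * z₀ + J₀₁ * z₁) * q₁ - (J₀₁ * z₀ + J₁₁ * z₁) * p₁))
        + a₂ * (p₂ * z₀ + q₂ * z₁) * (ε₂ * (p₂ * z₀ + q₂ * z₁) * ((J₀₀ * z₀ + J₀₁ * z₁) * q₀ - (J₀₁ * z₀ + J₁₁ * z₁) * p₀)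
          - ε₀ * (p₀ * z₀ + q₀ * z₁) * ((J₀₀ * z₀ + J₀₁ * z₁) * q₂ - (J₀₁ * z₀ + J₁₁ * z₁) * p₂))
        + a₃ * (p₃ * z₀ + q₃ * z₁) * (ε₃ * (p₃ * z₀ + q₃ * z₁) * ((J₀₀ * z₀ + J₀₁ * z₁) * q₀ - (J₀₁ * z₀ + J₁₁ * z₁) * p₀)
          - ε₀ * (p₀ * z₀ + q₀ * z₁) * ((J₀₀ * z₀ + J₀₁ * z₁) * q₃ - (J₀₁ * z₀ + J₁₁ * z₁) * p₃)) := by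
  linear_combination (ε₀ * (p₀ * z₀ + q₀ * z₁)) * hdet

/-- **VOTING IDENTITY (hyperbolic normal form).**  With `J` antidiagonal, `vₖ = (1, tₖ)` and `z = (g, −1)` where `g` is the RMS
direction, `∑ₖ aₖ(g² − tₖ²) = 0`: `(g + t₀)·∑ₖ εₖaₖ(g − tₖ)² = ∑_{k≥1} aₖ κₖ(g)` with the cubic votes
`κₖ(g) = (g − tₖ)·[εₖ(g − tₖ)(g + t₀) − ε₀(g − t₀)(g + tₖ)]`. [this file] -/
theorem voting_identity_rms (ε₀ ε₁ ε₂ ε₃ a₀ a₁ a₂ a₃ t₀ t₁ t₂ t₃ g : ℝ)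
    (hrms : a₀ * (g ^ 2 - t₀ ^ 2) + a₁ * (g ^ 2 - t₁ ^ 2) + a₂ * (g ^ 2 - t₂ ^ 2) + a₃ * (g ^ 2 - t₃ ^ 2) = 0) :
    (g + t₀) * (ε₀ * a₀ * (g - t₀) ^ 2 + ε₁ * a₁ * (g - t₁) ^ 2 + ε₂ * a₂ * (g - t₂) ^ 2 + ε₃ * a₃ * (g - t₃) ^ 2)
      = a₁ * ((g - t₁) * (ε₁ * (g - t₁) * (g + t₀) - ε₀ * (g - t₀) * (g + t₁)))
        + a₂ * ((g - t₂) * (ε₂ * (g - t₂) * (g + t₀) - ε₀ * (g - t₀) * (g + t₂)))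
        + a₃ * ((g - t₃) * (ε₃ * (g - t₃) * (g + t₀) - ε₀ * (g - t₀) * (g + t₃))) := by
  linear_combination (ε₀ * (g - t₀)) * hrms

/-- **No vote, no turn.**  In the setting of `voting_identity_rms` with `g + t₀ > 0`: if the total vote `∑_{k≥1} aₖκₖ(g)` is
positive then the signed sum of squares `∑ₖ εₖaₖ(g − tₖ)²` is positive (the profile rises); if it is negative, the sum is negative
(the profile falls).  So every turning point has its RMS direction `g` inside some letter's voting interval. [this file] -/
theorem sos_sign_of_votes (ε₀ ε₁ ε₂ ε₃ a₀ a₁ a₂ a₃ t₀ t₁ t₂ t₃ g : ℝ) (hg : 0 < g + t₀)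
    (hrms : a₀ * (g ^ 2 - t₀ ^ 2) + a₁ * (g ^ 2 - t₁ ^ 2) + a₂ * (g ^ 2 - t₂ ^ 2) + a₃ * (g ^ 2 - t₃ ^ 2) = 0) :
    (0 < a₁ * ((g - t₁) * (ε₁ * (g - t₁) * (g + t₀) - ε₀ * (g - t₀) * (g + t₁)))
        + a₂ * ((g - t₂) * (ε₂ * (g - t₂) * (g + t₀) - ε₀ * (g - t₀) * (g + t₂)))
        + a₃ * ((g - t₃) * (ε₃ * (g - t₃) * (g + t₀) - ε₀ * (g - t₀) * (g + t₃)))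
      → 0 < ε₀ * a₀ * (g - t₀) ^ 2 + ε₁ * a₁ * (g - t₁) ^ 2 + ε₂ * a₂ * (g - t₂) ^ 2 + ε₃ * a₃ * (g - t₃) ^ 2)
    ∧ (a₁ * ((g - t₁) * (ε₁ * (g - t₁) * (g + t₀) - ε₀ * (g - t₀) * (g + t₁)))
        + a₂ * ((g - t₂) * (ε₂ * (g - t₂) * (g + t₀) - ε₀ * (g - t₀) * (g + t₂)))
        + a₃ * ((g - t₃) * (ε₃ * (g - t₃) * (g + t₀) - ε₀ * (g - t₀) * (g + t₃))) < 0
      → ε₀ * a₀ * (g - t₀) ^ 2 + ε₁ * a₁ * (g - t₁) ^ 2 + ε₂ * a₂ * (g - t₂) ^ 2 + ε₃ * a₃ * (g - t₃) ^ 2 < 0) := by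
  have hid := voting_identity_rms ε₀ ε₁ ε₂ ε₃ a₀ a₁ a₂ a₃ t₀ t₁ t₂ t₃ g hrms
  set Γ := ε₀ * a₀ * (g - t₀) ^ 2 + ε₁ * a₁ * (g - t₁) ^ 2 + ε₂ * a₂ * (g - t₂) ^ 2 + ε₃ * a₃ * (g - t₃) ^ 2 with hΓ
  constructor
  · intro hV
    by_contra h; push Not at h
    have : (g + t₀) * Γ ≤ 0 := mul_nonpos_of_nonneg_of_nonpos hg.le h
    linarith
  · intro hV
    by_contra h; push Not at h
    have : 0 ≤ (g + t₀) * Γ := mul_nonneg hg.le h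
    linarith

/-- The quadratic factor of the vote: `εₖ(g − tₖ)(g + t₀) − ε₀(g − t₀)(g + tₖ) = (εₖ − ε₀)g² + (εₖ + ε₀)(t₀ − tₖ)g − (εₖ − ε₀)t₀tₖ`. -/
theorem voteQuad_eq (ε₀ εk t₀ tk g : ℝ) :
    εk * (g - tk) * (g + t₀) - ε₀ * (g - t₀) * (g + tk) = (εk - ε₀) * g ^ 2 + (εk + ε₀) * (t₀ - tk) * g - (εk - ε₀) * (t₀ * tk) := by
  ring

/-- The vote's quadratic at `g = t₀`: `2εₖt₀(t₀ − tₖ)`. -/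
theorem q_at_t0 (ε₀ εk t₀ tk : ℝ) :
    (εk - ε₀) * t₀ ^ 2 + (εk + ε₀) * (t₀ - tk) * t₀ - (εk - ε₀) * (t₀ * tk) = 2 * εk * t₀ * (t₀ - tk) := by ring

/-- The vote's quadratic at `g = tₖ`: `−2ε₀tₖ(tₖ − t₀)`. -/
theorem q_at_tk (ε₀ εk t₀ tk : ℝ) :
    (εk - ε₀) * tk ^ 2 + (εk + ε₀) * (t₀ - tk) * tk - (εk - ε₀) * (t₀ * tk) = -2 * ε₀ * tk * (tk - t₀) := by ring

/-- The vote's quadratic at the band point `g = c·tₖ`, `c(εₖ − ε₀) = εₖ + ε₀`: value `(εₖ − ε₀)t₀tₖ(c² − 1)`. -/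
theorem q_at_band (ε₀ εk t₀ tk c : ℝ) (hc : c * (εk - ε₀) = εk + ε₀) :
    (εk - ε₀) * (c * tk) ^ 2 + (εk + ε₀) * (t₀ - tk) * (c * tk) - (εk - ε₀) * (t₀ * tk) = (εk - ε₀) * (t₀ * tk) * (c ^ 2 - 1) := by
  rw [← hc]; ring

/-- The vote's quadratic at the outer band point `g = tₖ/c`: value `(εₖ − ε₀)tₖ²(1 − c²)/c²`. -/
theorem q_at_band' (ε₀ εk t₀ tk c : ℝ) (hc : c * (εk - ε₀) = εk + ε₀) (hc0 : c ≠ 0) :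
    (εk - ε₀) * (tk / c) ^ 2 + (εk + ε₀) * (t₀ - tk) * (tk / c) - (εk - ε₀) * (t₀ * tk) = (εk - ε₀) * tk ^ 2 * (1 - c ^ 2) / c ^ 2 := by
  rw [← hc]; field_simp; ring

/-- **Monotonicity of `q(g)/g`.**  For a quadratic `q(g) = Pg² + Bg − D` with `P > 0`, `D > 0`: `0 < g ≤ g'` implies `g'·q(g) ≤ g·q(g')`
(so `q/g` is increasing on `(0,∞)` and `q` has exactly one positive root, changing sign from `−` to `+` there). [folklore] -/
theorem q_div_mono (P B D g g' : ℝ) (hP : 0 < P) (hD : 0 < D) (hg : 0 < g) (hgg : g ≤ g') :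
    g' * (P * g ^ 2 + B * g - D) ≤ g * (P * g' ^ 2 + B * g' - D) := by
  have h : g * (P * g' ^ 2 + B * g' - D) - g' * (P * g ^ 2 + B * g - D) = (g' - g) * (P * g * g' + D) := by ring
  nlinarith [mul_nonneg (sub_nonneg.2 hgg) (add_pos (mul_pos (mul_pos hP hg) (lt_of_lt_of_le hg hgg)) hD).le]

/-! ## 3. Chamber-(C) bands -/

/-- **LOCAL VOTERS (letters with `d₀ + dₖ > 2e`), case `t₀ < tₖ`.**  Let `ε₀ < 0 < εₖ + ε₀` (so `εₖ > 0`), `0 < t₀ < tₖ`, and let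
`c ∈ (0,1)` with `c(εₖ − ε₀) = εₖ + ε₀`.  If letter `k`'s vote at a direction `g > 0` is negative, `(g − tₖ)·qₖ(g) < 0`, then
`c·tₖ < g < tₖ`: the letter votes for a dip only in the relative band of width `c` below `tₖ`. [this file] -/
theorem vote_band_of_neg (ε₀ εk t₀ tk c g : ℝ) (hε₀ : ε₀ < 0) (hεs : 0 < εk + ε₀) (ht₀ : 0 < t₀) (htk : t₀ < tk)
    (hc : c * (εk - ε₀) = εk + ε₀) (hc0 : 0 < c) (hg : 0 < g)
    (hvote : (g - tk) * ((εk - ε₀) * g ^ 2 + (εk + ε₀) * (t₀ - tk) * g - (εk - ε₀) * (t₀ * tk)) < 0) :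
    c * tk < g ∧ g < tk := by
  have hεk : 0 < εk := by linarith
  have hP : 0 < εk - ε₀ := by linarith
  have hD : 0 < (εk - ε₀) * (t₀ * tk) := mul_pos hP (mul_pos ht₀ (ht₀.trans htk))
  have hc1 : c < 1 := by nlinarith
  set qg := (εk - ε₀) * g ^ 2 + (εk + ε₀) * (t₀ - tk) * g - (εk - ε₀) * (t₀ * tk) with hqg
  -- `q(tₖ) > 0`
  have hqtk : 0 < (εk - ε₀) * tk ^ 2 + (εk + ε₀) * (t₀ - tk) * tk - (εk - ε₀) * (t₀ * tk) := by
    rw [q_at_tk]; nlinarith [mul_pos (ht₀.trans htk) (sub_pos.2 htk)]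
  -- `q(c tₖ) < 0`
  have hqc : (εk - ε₀) * (c * tk) ^ 2 + (εk + ε₀) * (t₀ - tk) * (c * tk) - (εk - ε₀) * (t₀ * tk) < 0 := by
    rw [q_at_band ε₀ εk t₀ tk c hc]
    have : c ^ 2 - 1 < 0 := by nlinarith
    exact mul_neg_of_pos_of_neg hD this
  constructor
  · -- if `g ≤ c tₖ` then `q(g) < 0` (monotone `q/g`), and `g < tₖ`, so the vote is positive
    by_contra hle
    push Not at hle
    have hmono := q_div_mono (εk - ε₀) ((εk + ε₀) * (t₀ - tk)) ((εk - ε₀) * (t₀ * tk)) g (c * tk) hP hD hg hle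
    have hctk : 0 < c * tk := mul_pos hc0 (ht₀.trans htk)
    have hqneg : qg < 0 := by
      by_contra hq; push Not at hq
      have : 0 ≤ c * tk * qg := mul_nonneg hctk.le hq
      nlinarith [mul_pos hg (neg_pos.2 hqc)]
    have hgt : g < tk := lt_of_le_of_lt hle (by nlinarith)
    have : 0 < (g - tk) * qg := mul_pos_of_neg_of_neg (sub_neg.2 hgt) hqneg
    linarith
  · -- if `g ≥ tₖ` then `q(g) > 0` and `g − tₖ ≥ 0`: vote ≥ 0
    by_contra hge
    push Not at hge
    have hmono := q_div_mono (εk - ε₀) ((εk + ε₀) * (t₀ - tk)) ((εk - ε₀) * (t₀ * tk)) tk g hP hD (ht₀.trans htk) hge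
    have hqpos : 0 < qg := by
      by_contra hq; push Not at hq
      have h1 : g * ((εk - ε₀) * tk ^ 2 + (εk + ε₀) * (t₀ - tk) * tk - (εk - ε₀) * (t₀ * tk)) ≤ tk * qg := hmono
      have h2 : 0 < g * ((εk - ε₀) * tk ^ 2 + (εk + ε₀) * (t₀ - tk) * tk - (εk - ε₀) * (t₀ * tk)) := mul_pos hg hqtk
      have h3 : tk * qg ≤ 0 := mul_nonpos_of_nonneg_of_nonpos (ht₀.trans htk).le hq
      linarith
    have : 0 ≤ (g - tk) * qg := mul_nonneg (sub_nonneg.2 hge) hqpos.le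
    linarith

/-- **LOCAL VOTERS, case `tₖ < t₀`.**  Same hypotheses with `0 < tₖ < t₀`: a negative vote forces `tₖ < g < tₖ/c`. [this file] -/
theorem vote_band_of_neg' (ε₀ εk t₀ tk c g : ℝ) (hε₀ : ε₀ < 0) (hεs : 0 < εk + ε₀) (htk : 0 < tk) (ht₀ : tk < t₀)
    (hc : c * (εk - ε₀) = εk + ε₀) (hc0 : 0 < c) (hg : 0 < g)
    (hvote : (g - tk) * ((εk - ε₀) * g ^ 2 + (εk + ε₀) * (t₀ - tk) * g - (εk - ε₀) * (t₀ * tk)) < 0) :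
    tk < g ∧ g < tk / c := by
  have hεk : 0 < εk := by linarith
  have hP : 0 < εk - ε₀ := by linarith
  have ht₀' : 0 < t₀ := htk.trans ht₀
  have hD : 0 < (εk - ε₀) * (t₀ * tk) := mul_pos hP (mul_pos ht₀' htk)
  have hc1 : c < 1 := by nlinarith
  set qg := (εk - ε₀) * g ^ 2 + (εk + ε₀) * (t₀ - tk) * g - (εk - ε₀) * (t₀ * tk) with hqg
  -- `q(tₖ) < 0`
  have hqtk : (εk - ε₀) * tk ^ 2 + (εk + ε₀) * (t₀ - tk) * tk - (εk - ε₀) * (t₀ * tk) < 0 := by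
    rw [q_at_tk]
    have : tk * (tk - t₀) < 0 := mul_neg_of_pos_of_neg htk (sub_neg.2 ht₀)
    nlinarith
  -- `q(tₖ/c) > 0`
  have hqc : 0 < (εk - ε₀) * (tk / c) ^ 2 + (εk + ε₀) * (t₀ - tk) * (tk / c) - (εk - ε₀) * (t₀ * tk) := by
    rw [q_at_band' ε₀ εk t₀ tk c hc hc0.ne']
    apply div_pos _ (by positivity)
    have : 0 < 1 - c ^ 2 := by nlinarith
    exact mul_pos (mul_pos hP (by positivity)) this
  constructor
  · -- if `g ≤ tₖ` then `q(g) < 0` and `g − tₖ ≤ 0`: vote ≥ 0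
    by_contra hle
    push Not at hle
    have hmono := q_div_mono (εk - ε₀) ((εk + ε₀) * (t₀ - tk)) ((εk - ε₀) * (t₀ * tk)) g tk hP hD hg hle
    have hqneg : qg < 0 := by
      by_contra hq; push Not at hq
      have : 0 ≤ tk * qg := mul_nonneg htk.le hq
      nlinarith [mul_pos hg (neg_pos.2 hqtk)]
    have : 0 ≤ (g - tk) * qg := mul_nonneg_of_nonpos_of_nonpos (sub_nonpos.2 hle) hqneg.le
    linarith
  · -- if `g ≥ tₖ/c` then `q(g) > 0` and `g > tₖ`: vote > 0
    by_contra hge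
    push Not at hge
    have htkc : 0 < tk / c := div_pos htk hc0
    have hmono := q_div_mono (εk - ε₀) ((εk + ε₀) * (t₀ - tk)) ((εk - ε₀) * (t₀ * tk)) (tk / c) g hP hD htkc hge
    have hqpos : 0 < qg := by
      by_contra hq; push Not at hq
      have h2 : 0 < g * ((εk - ε₀) * (tk / c) ^ 2 + (εk + ε₀) * (t₀ - tk) * (tk / c) - (εk - ε₀) * (t₀ * tk)) := mul_pos hg hqc
      have h3 : tk / c * qg ≤ 0 := mul_nonpos_of_nonneg_of_nonpos htkc.le hq
      linarith
    have hgt : tk < g := by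
      have : tk < tk / c := by rw [lt_div_iff₀ hc0]; nlinarith
      linarith
    have : 0 < (g - tk) * qg := mul_pos (sub_pos.2 hgt) hqpos
    linarith

/-- **GLOBAL VOTER (letter with `d₀ + d₁ < 2e`), case `t₀ < t₁`.**  Let `ε₁ + ε₀ < 0 < ε₁` (so `ε₀ < 0`), `0 < t₀ < t₁`, and
`C > 1` with `C·(−(ε₁ + ε₀)) = ε₁ − ε₀`.  Then for every direction `g` with `C·t₀ < g < t₁` letter 1's vote is negative:
`(g − t₁)·q₁(g) < 0`. [this file] -/
theorem vote_neg_of_mem (ε₀ ε₁ t₀ t₁ C g : ℝ) (hε₁ : 0 < ε₁) (hεs : ε₁ + ε₀ < 0) (ht₀ : 0 < t₀) (ht₁ : t₀ < t₁)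
    (hC : C * (-(ε₁ + ε₀)) = ε₁ - ε₀) (hC0 : 0 < C) (hg1 : C * t₀ < g) (hg2 : g < t₁) :
    (g - t₁) * ((ε₁ - ε₀) * g ^ 2 + (ε₁ + ε₀) * (t₀ - t₁) * g - (ε₁ - ε₀) * (t₀ * t₁)) < 0 := by
  have hε₀ : ε₀ < 0 := by linarith
  have hP : 0 < ε₁ - ε₀ := by linarith
  have hD : 0 < (ε₁ - ε₀) * (t₀ * t₁) := mul_pos hP (mul_pos ht₀ (ht₀.trans ht₁))
  -- `q₁(C t₀) = (ε₁ − ε₀) t₀² (C² − 1) > 0`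
  have hqC : 0 < (ε₁ - ε₀) * (C * t₀) ^ 2 + (ε₁ + ε₀) * (t₀ - t₁) * (C * t₀) - (ε₁ - ε₀) * (t₀ * t₁) := by
    have hid : (ε₁ - ε₀) * (C * t₀) ^ 2 + (ε₁ + ε₀) * (t₀ - t₁) * (C * t₀) - (ε₁ - ε₀) * (t₀ * t₁)
        = (ε₁ - ε₀) * t₀ ^ 2 * (C ^ 2 - 1) := by
      have h' : ε₁ - ε₀ = C * (-(ε₁ + ε₀)) := hC.symm
      rw [h']; ring
    rw [hid]
    have hC1 : 1 < C := by nlinarith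
    have : 0 < C ^ 2 - 1 := by nlinarith
    exact mul_pos (mul_pos hP (by positivity)) this
  have hg : 0 < g := lt_trans (mul_pos hC0 ht₀) hg1
  have hmono := q_div_mono (ε₁ - ε₀) ((ε₁ + ε₀) * (t₀ - t₁)) ((ε₁ - ε₀) * (t₀ * t₁)) (C * t₀) g hP hD (mul_pos hC0 ht₀) hg1.le
  have hqpos : 0 < (ε₁ - ε₀) * g ^ 2 + (ε₁ + ε₀) * (t₀ - t₁) * g - (ε₁ - ε₀) * (t₀ * t₁) := by
    by_contra hq; push Not at hq
    have h2 : 0 < g * ((ε₁ - ε₀) * (C * t₀) ^ 2 + (ε₁ + ε₀) * (t₀ - t₁) * (C * t₀) - (ε₁ - ε₀) * (t₀ * t₁)) := mul_pos hg hqC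
    have h3 : C * t₀ * ((ε₁ - ε₀) * g ^ 2 + (ε₁ + ε₀) * (t₀ - t₁) * g - (ε₁ - ε₀) * (t₀ * t₁)) ≤ 0 :=
      mul_nonpos_of_nonneg_of_nonpos (mul_pos hC0 ht₀).le hq
    linarith
  exact mul_neg_of_neg_of_pos (sub_neg.2 hg2) hqpos

end Summit.ValiantsHypothesis.ValiantsHypothesis.Theorems.LacunarySymmetroidMatrixDescartes.Pivot.Resolvent
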